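import Summits.AtomisticToContinuum.FouriersLaw.Theses.HiddenChargeMazur
import Summits.AtomisticToContinuum.FouriersLaw.Theorems.HiddenChargeMazurNoOddChargeGibbsBounds
import Summits.AtomisticToContinuum.FouriersLaw.Theorems.LatticeLandauDampingAbelThermodynamicLimitBulkWindowEquivalence
import Literature.MathematicalPhysics.KineticTheory.InfiniteChainGibbsExistenceShift

/-!
# Stub `stub_overlapDensityLimit` of crux `OddChargeExists` — part 1/4: `N`-uniform moments

`--supports stmt-AtomisticToContinuum-13511` (crux `HiddenChargeMazur.OddChargeExists`, line `registered` =
`Cruxes/OddChargeExists/Lines/birth.lean`, stub `stub_overlapDensityLimit`: the thermodynamic limit of the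
current-overlap density). This first helper file supplies the `N`-UNIFORM STATICS of the free finite-volume Gibbs
state `μ_{N,T} = gibbsMeasure N T` of `pinnedChain ω₂ lam β γ`:

* polynomial growth of `MvPolynomial.eval` on boxes (`exists_abs_eval_le`);
* Gaussian momentum moments of every order, exactly (`pinnedChain_gibbs_momentum_even_moment`, from the recursion
  `NoOddCharge.pinnedChain_integral_momentum_pow_add_two'`), and `N`-uniform even moments of positions AND momenta
  at every site (`pinnedChain_gibbs_even_moments_le`, positions from
  `PhononMeanFreePath.lightCone_gibbs_position_moments`);
* site sums `1 + Σ_t (q_{s t}² + p_{s t}²)`: energy domination, integrability of every continuous observable they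
  dominate, and `N`-uniform moments of all their powers (`pinnedChain_gibbs_siteSum_pow_le`, power-mean inequality).

All statements proved; `[folklore]`. No definitions, no named facts.
-/

noncomputable section

open MeasureTheory Set Function Finset Filter Topology
open scoped BigOperators

namespace Summit.AtomisticToContinuum.FouriersLaw.Theorems.OddChargeExists.OverlapDensityLimit

open Literature.MathematicalPhysics.KineticTheory.HeatConduction OscillatorChain
open Summit.AtomisticToContinuum.FouriersLaw.Theorems.LightConeBondHeat
open Summit.AtomisticToContinuum.FouriersLaw.Theorems.NoOddCharge

/-! ### §1 Polynomial growth -/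

/-- **Polynomial growth.** A real polynomial in finitely or infinitely many variables is bounded by
`C · B^d` on the box `{|v_s| ≤ B}` (`B ≥ 1`). [folklore] -/
theorem exists_abs_eval_le {σ : Type*} (p : MvPolynomial σ ℝ) :
    ∃ C : ℝ, 0 ≤ C ∧ ∃ d : ℕ, ∀ (v : σ → ℝ) (B : ℝ), 1 ≤ B → (∀ s, |v s| ≤ B) →
      |MvPolynomial.eval v p| ≤ C * B ^ d := by
  induction p using MvPolynomial.induction_on with
  | C a =>
    refine ⟨|a|, abs_nonneg a, 0, fun v B _ _ => ?_⟩
    simp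
  | add p q hp hq =>
    obtain ⟨Cp, hCp, dp, hp⟩ := hp
    obtain ⟨Cq, hCq, dq, hq⟩ := hq
    refine ⟨Cp + Cq, add_nonneg hCp hCq, max dp dq, fun v B hB hv => ?_⟩
    rw [map_add]
    have h1 := hp v B hB hv
    have h2 := hq v B hB hv
    have h3 : B ^ dp ≤ B ^ max dp dq := pow_le_pow_right₀ hB (le_max_left _ _)
    have h4 : B ^ dq ≤ B ^ max dp dq := pow_le_pow_right₀ hB (le_max_right _ _)
    calc |MvPolynomial.eval v p + MvPolynomial.eval v q|
        ≤ |MvPolynomial.eval v p| + |MvPolynomial.eval v q| := abs_add_le _ _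
      _ ≤ Cp * B ^ max dp dq + Cq * B ^ max dp dq := by
          gcongr
          · exact h1.trans (mul_le_mul_of_nonneg_left h3 hCp)
          · exact h2.trans (mul_le_mul_of_nonneg_left h4 hCq)
      _ = (Cp + Cq) * B ^ max dp dq := by ring
  | mul_X p s hp =>
    obtain ⟨Cp, hCp, dp, hp⟩ := hp
    refine ⟨Cp, hCp, dp + 1, fun v B hB hv => ?_⟩
    rw [map_mul, MvPolynomial.eval_X, abs_mul, pow_succ, ← mul_assoc]
    exact mul_le_mul (hp v B hB hv) (hv s) (abs_nonneg _) (mul_nonneg hCp (pow_nonneg (by linarith) _))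

/-! ### §2 `N`-uniform one-site moments of the free finite-volume Gibbs state -/

section Pinned

variable {ω₂ lam β : ℝ}

/-- **Gaussian momentum moments**: `E_{μ_{N,T}}[p_i^{2k}] = ∏_{j<k} T(2j+1)`, in particular
`N`-uniform. [folklore] -/
theorem pinnedChain_gibbs_momentum_even_moment (hω : 0 < ω₂) (hl : 0 ≤ lam) (hβ : 0 ≤ β) (γ : ℝ)
    {T : ℝ} (hT : 0 < T) (k : ℕ) (N : ℕ) (i : Fin N) :
    Integrable (fun z : PhaseSpace N => z.2 i ^ (2 * k)) ((pinnedChain ω₂ lam β γ).gibbsMeasure N T) ∧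
      ∫ z, z.2 i ^ (2 * k) ∂((pinnedChain ω₂ lam β γ).gibbsMeasure N T) = ∏ j ∈ Finset.range k, T * (2 * j + 1) := by
  set P := pinnedChain ω₂ lam β γ with hP
  refine ⟨P.integrable_gibbsMeasure (pinnedChain_integrable_momentum_pow_mul_gibbsDensity' hω hl hβ γ N hT i _), ?_⟩
  have hrec : ∀ k : ℕ, ∫ z, z.2 i ^ (2 * k) * P.gibbsDensity N T z =
      (∏ j ∈ Finset.range k, T * (2 * j + 1)) * ∫ z, P.gibbsDensity N T z := by
    intro k
    induction k with
    | zero => simp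
    | succ k ih =>
      rw [show 2 * (k + 1) = 2 * k + 2 by ring, pinnedChain_integral_momentum_pow_add_two' hω hl hβ γ N hT i,
        ih, Finset.prod_range_succ]
      push_cast
      ring
  have hZ : 0 < ∫ z, P.gibbsDensity N T z := integral_exp_pos (pinnedChain_integrable_gibbsDensity hω hl hβ γ N hT)
  rw [P.integral_gibbsMeasure, hrec, ← mul_assoc, mul_comm _ (∏ j ∈ Finset.range k, T * (2 * j + 1)), mul_assoc,
    inv_mul_cancel₀ hZ.ne', mul_one]

/-- **`N`-uniform even moments at every site**, positions and momenta together: for every `k` there is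
`K` with `E_{μ_{N,T}}[q_i^{2k}] ≤ K` and `E_{μ_{N,T}}[p_i^{2k}] ≤ K` for all `N` and all sites `i`, all
integrable. [folklore] -/
theorem pinnedChain_gibbs_even_moments_le (hω : 0 < ω₂) (hl : 0 < lam) (hβ : 0 ≤ β) (γ : ℝ)
    {T : ℝ} (hT : 0 < T) (k : ℕ) :
    ∃ K : ℝ, ∀ (N : ℕ) (i : Fin N),
      Integrable (fun z : PhaseSpace N => z.1 i ^ (2 * k)) ((pinnedChain ω₂ lam β γ).gibbsMeasure N T) ∧
      ∫ z, z.1 i ^ (2 * k) ∂((pinnedChain ω₂ lam β γ).gibbsMeasure N T) ≤ K ∧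
      Integrable (fun z : PhaseSpace N => z.2 i ^ (2 * k)) ((pinnedChain ω₂ lam β γ).gibbsMeasure N T) ∧
      ∫ z, z.2 i ^ (2 * k) ∂((pinnedChain ω₂ lam β γ).gibbsMeasure N T) ≤ K := by
  obtain ⟨C, hC⟩ := Summit.AtomisticToContinuum.FouriersLaw.Theorems.PhononMeanFreePath.lightCone_gibbs_position_moments
    ω₂ lam β γ hω hl.le hβ T hT k
  refine ⟨max C (∏ j ∈ Finset.range k, T * (2 * j + 1)), fun N i => ?_⟩
  obtain ⟨N', rfl⟩ : ∃ N', N = N' + 1 := ⟨N - 1, by have := i.pos; omega⟩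
  obtain ⟨hqi, hq⟩ := hC N' i
  obtain ⟨hpi, hp⟩ := pinnedChain_gibbs_momentum_even_moment hω hl.le hβ γ hT k (N' + 1) i
  exact ⟨hqi, hq.trans (le_max_left _ _), hpi, hp.le.trans (le_max_right _ _)⟩


/-! ### §3 Site sums: energy domination, integrability, `N`-uniform moments -/

/-- `1 ≤ 1 + Σ_t (q_{s t}² + p_{s t}²)`. [folklore] -/
theorem one_le_siteSum {N n : ℕ} (s : Fin n → Fin N) (z : PhaseSpace N) :
    1 ≤ 1 + ∑ t : Fin n, (z.1 (s t) ^ 2 + z.2 (s t) ^ 2) :=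
  le_add_of_nonneg_right (Finset.sum_nonneg fun t _ => by positivity)

/-- `|q_{s t}| ≤ 1 + Σ_t (q_{s t}² + p_{s t}²)`. [folklore] -/
theorem abs_fst_le_siteSum {N n : ℕ} (s : Fin n → Fin N) (z : PhaseSpace N) (t : Fin n) :
    |z.1 (s t)| ≤ 1 + ∑ t : Fin n, (z.1 (s t) ^ 2 + z.2 (s t) ^ 2) := by
  have h1 : |z.1 (s t)| ≤ 1 + z.1 (s t) ^ 2 := by
    nlinarith [sq_nonneg (|z.1 (s t)| - 1), sq_abs (z.1 (s t)), abs_nonneg (z.1 (s t))]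
  have h2 : z.1 (s t) ^ 2 + z.2 (s t) ^ 2 ≤ ∑ t : Fin n, (z.1 (s t) ^ 2 + z.2 (s t) ^ 2) :=
    Finset.single_le_sum (f := fun t => z.1 (s t) ^ 2 + z.2 (s t) ^ 2) (fun t _ => by positivity)
      (Finset.mem_univ t)
  nlinarith [sq_nonneg (z.2 (s t))]

/-- `|p_{s t}| ≤ 1 + Σ_t (q_{s t}² + p_{s t}²)`. [folklore] -/
theorem abs_snd_le_siteSum {N n : ℕ} (s : Fin n → Fin N) (z : PhaseSpace N) (t : Fin n) :
    |z.2 (s t)| ≤ 1 + ∑ t : Fin n, (z.1 (s t) ^ 2 + z.2 (s t) ^ 2) := by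
  have h1 : |z.2 (s t)| ≤ 1 + z.2 (s t) ^ 2 := by
    nlinarith [sq_nonneg (|z.2 (s t)| - 1), sq_abs (z.2 (s t)), abs_nonneg (z.2 (s t))]
  have h2 : z.1 (s t) ^ 2 + z.2 (s t) ^ 2 ≤ ∑ t : Fin n, (z.1 (s t) ^ 2 + z.2 (s t) ^ 2) :=
    Finset.single_le_sum (f := fun t => z.1 (s t) ^ 2 + z.2 (s t) ^ 2) (fun t _ => by positivity)
      (Finset.mem_univ t)
  nlinarith [sq_nonneg (z.1 (s t))]

/-- **Energy domination of site sums**: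
`1 + Σ_t (q_{s t}² + p_{s t}²) ≤ (1 + n((1+4/lam)² + 16)) (1+H)⁴` (`lam > 0`). [folklore] -/
theorem pinnedChain_siteSum_le_energy (hω : 0 ≤ ω₂) (hl : 0 < lam) (hβ : 0 ≤ β) (γ : ℝ) {N n : ℕ}
    (s : Fin n → Fin N) (z : PhaseSpace N) :
    1 + ∑ t : Fin n, (z.1 (s t) ^ 2 + z.2 (s t) ^ 2) ≤
      (1 + n * ((1 + 4 / lam) ^ 2 + 16)) * (1 + (pinnedChain ω₂ lam β γ).hamiltonian N z) ^ 4 := by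
  set Hm := (pinnedChain ω₂ lam β γ).hamiltonian N z with hHm
  have hH0 : 0 ≤ Hm := pinnedChain_hamiltonian_nonneg hω hl.le hβ γ N z
  have h1 : (1 : ℝ) ≤ (1 + Hm) ^ 4 := one_le_pow₀ (by linarith)
  have hq : ∀ i : Fin N, z.1 i ^ 2 ≤ (1 + 4 / lam) ^ 2 * (1 + Hm) ^ 4 := by
    intro i
    have h := pinnedChain_abs_position_pow_le_pow hω hl hβ γ N z i 2
    rw [abs_of_nonneg (sq_nonneg _)] at h
    refine h.trans (mul_le_mul_of_nonneg_left ?_ (by positivity))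
    exact pow_le_pow_right₀ (by linarith) (by norm_num)
  have hp : ∀ i : Fin N, z.2 i ^ 2 ≤ 16 * (1 + Hm) ^ 4 := by
    intro i
    have h := pinnedChain_abs_momentum_pow_le_pow hω hl.le hβ γ N z i 2
    rw [abs_of_nonneg (sq_nonneg _)] at h
    norm_num at h
    exact h
  have hsum : ∑ t : Fin n, (z.1 (s t) ^ 2 + z.2 (s t) ^ 2) ≤
      ∑ _t : Fin n, ((1 + 4 / lam) ^ 2 + 16) * (1 + Hm) ^ 4 :=
    Finset.sum_le_sum fun t _ => by nlinarith [hq (s t), hp (s t)]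
  rw [Finset.sum_const, Finset.card_univ, Fintype.card_fin, nsmul_eq_mul] at hsum
  have hK : (0 : ℝ) ≤ n * ((1 + 4 / lam) ^ 2 + 16) := by positivity
  nlinarith

/-- **Integrability of site-sum dominated observables**: a continuous `Φ` with
`|Φ| ≤ C (1 + Σ_t (q_{s t}² + p_{s t}²))^d` is integrable against `μ_{N,T}`. [folklore] -/
theorem pinnedChain_integrable_gibbs_of_le_siteSum (hω : 0 < ω₂) (hl : 0 < lam) (hβ : 0 ≤ β) (γ : ℝ)
    {T : ℝ} (hT : 0 < T) {N n : ℕ} (s : Fin n → Fin N) {Φ : PhaseSpace N → ℝ} (hΦ : Continuous Φ)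
    {C : ℝ} (hC : 0 ≤ C) (d : ℕ)
    (hle : ∀ z, |Φ z| ≤ C * (1 + ∑ t : Fin n, (z.1 (s t) ^ 2 + z.2 (s t) ^ 2)) ^ d) :
    Integrable Φ ((pinnedChain ω₂ lam β γ).gibbsMeasure N T) := by
  refine (pinnedChain ω₂ lam β γ).integrable_gibbsMeasure
    (pinnedChain_integrable_mul_gibbsDensity_of_le_pow hω hl.le hβ γ N hT (4 * d) hΦ
      (C := C * (1 + n * ((1 + 4 / lam) ^ 2 + 16)) ^ d) fun z => ?_)
  have h := pinnedChain_siteSum_le_energy hω.le hl hβ γ s z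
  have h0 : (0 : ℝ) ≤ 1 + ∑ t : Fin n, (z.1 (s t) ^ 2 + z.2 (s t) ^ 2) :=
    zero_le_one.trans (one_le_siteSum s z)
  calc |Φ z| ≤ C * (1 + ∑ t : Fin n, (z.1 (s t) ^ 2 + z.2 (s t) ^ 2)) ^ d := hle z
    _ ≤ C * ((1 + n * ((1 + 4 / lam) ^ 2 + 16)) * (1 + (pinnedChain ω₂ lam β γ).hamiltonian N z) ^ 4) ^ d :=
        mul_le_mul_of_nonneg_left (pow_le_pow_left₀ h0 h d) hC
    _ = _ := by rw [mul_pow, ← pow_mul, mul_assoc]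

/-- **`N`-uniform moments of site sums**: for all `n, d` there is `Mo` with
`E_{μ_{N,T}}[(1 + Σ_{t<n} (q_{s t}² + p_{s t}²))^d] ≤ Mo` for every `N` and every choice of `n` sites
`s : Fin n → Fin N` (power-mean inequality and the one-site moments). [folklore] -/
theorem pinnedChain_gibbs_siteSum_pow_le (hω : 0 < ω₂) (hl : 0 < lam) (hβ : 0 ≤ β) (γ : ℝ) {T : ℝ}
    (hT : 0 < T) (n d : ℕ) :
    ∃ Mo : ℝ, ∀ (N : ℕ) (s : Fin n → Fin N),
      Integrable (fun z : PhaseSpace N => (1 + ∑ t : Fin n, (z.1 (s t) ^ 2 + z.2 (s t) ^ 2)) ^ d)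
          ((pinnedChain ω₂ lam β γ).gibbsMeasure N T) ∧
        ∫ z, (1 + ∑ t : Fin n, (z.1 (s t) ^ 2 + z.2 (s t) ^ 2)) ^ d
          ∂((pinnedChain ω₂ lam β γ).gibbsMeasure N T) ≤ Mo := by
  obtain ⟨K, hK⟩ := pinnedChain_gibbs_even_moments_le hω hl hβ γ hT (d + 1)
  set cO : ℝ := (Fintype.card (Option (Fin n ⊕ Fin n)) : ℝ) with hcO
  refine ⟨cO ^ d * (1 + n * (K + K)), fun N s => ?_⟩
  set P := pinnedChain ω₂ lam β γ with hP
  set μ := P.gibbsMeasure N T with hμ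
  haveI : IsProbabilityMeasure μ := pinnedChain_isProbabilityMeasure_gibbsMeasure hω hl.le hβ γ N hT
  have hcont : Continuous fun z : PhaseSpace N => (1 + ∑ t : Fin n, (z.1 (s t) ^ 2 + z.2 (s t) ^ 2)) ^ d := by
    fun_prop
  have hint : Integrable (fun z : PhaseSpace N => (1 + ∑ t : Fin n, (z.1 (s t) ^ 2 + z.2 (s t) ^ 2)) ^ d) μ :=
    pinnedChain_integrable_gibbs_of_le_siteSum hω hl hβ γ hT s hcont zero_le_one d fun z => by
      rw [one_mul, abs_of_nonneg (pow_nonneg (zero_le_one.trans (one_le_siteSum s z)) _)]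
  refine ⟨hint, ?_⟩
  -- pointwise power-mean inequality
  have hpt : ∀ z : PhaseSpace N, (1 + ∑ t : Fin n, (z.1 (s t) ^ 2 + z.2 (s t) ^ 2)) ^ d ≤
      cO ^ d * (1 + ∑ t : Fin n, (z.1 (s t) ^ (2 * (d + 1)) + z.2 (s t) ^ (2 * (d + 1)))) := by
    intro z
    set a : Option (Fin n ⊕ Fin n) → ℝ :=
      fun o => o.elim 1 (Sum.elim (fun t => z.1 (s t) ^ 2) (fun t => z.2 (s t) ^ 2)) with ha
    have ha0 : ∀ o ∈ (Finset.univ : Finset (Option (Fin n ⊕ Fin n))), 0 ≤ a o := by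
      rintro (_ | _ | _) _
      · simp [ha]
      · simp only [ha, Option.elim_some, Sum.elim_inl]; positivity
      · simp only [ha, Option.elim_some, Sum.elim_inr]; positivity
    have hsum : ∑ o, a o = 1 + ∑ t : Fin n, (z.1 (s t) ^ 2 + z.2 (s t) ^ 2) := by
      rw [Fintype.sum_option, Fintype.sum_sum_type, Finset.sum_add_distrib]
      simp [ha]
    have hsum' : ∑ o, a o ^ (d + 1) = 1 + ∑ t : Fin n, (z.1 (s t) ^ (2 * (d + 1)) + z.2 (s t) ^ (2 * (d + 1))) := by
      rw [Fintype.sum_option, Fintype.sum_sum_type, Finset.sum_add_distrib]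
      simp [ha, pow_mul]
    have hpm := pow_sum_le_card_mul_sum_pow ha0 d
    rw [hsum, hsum', Finset.card_univ] at hpm
    calc (1 + ∑ t : Fin n, (z.1 (s t) ^ 2 + z.2 (s t) ^ 2)) ^ d
        ≤ (1 + ∑ t : Fin n, (z.1 (s t) ^ 2 + z.2 (s t) ^ 2)) ^ (d + 1) :=
          pow_le_pow_right₀ (one_le_siteSum s z) (Nat.le_succ d)
      _ ≤ _ := hpm
  -- integrate
  have hIq : ∀ t, Integrable (fun z : PhaseSpace N => z.1 (s t) ^ (2 * (d + 1))) μ := fun t => (hK N (s t)).1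
  have hIp : ∀ t, Integrable (fun z : PhaseSpace N => z.2 (s t) ^ (2 * (d + 1))) μ := fun t => (hK N (s t)).2.2.1
  have hIs : Integrable (fun z : PhaseSpace N =>
      ∑ t : Fin n, (z.1 (s t) ^ (2 * (d + 1)) + z.2 (s t) ^ (2 * (d + 1)))) μ :=
    integrable_finsetSum _ fun t _ => (hIq t).add (hIp t)
  have hrhs : Integrable (fun z : PhaseSpace N =>
      cO ^ d * (1 + ∑ t : Fin n, (z.1 (s t) ^ (2 * (d + 1)) + z.2 (s t) ^ (2 * (d + 1))))) μ :=
    ((integrable_const 1).add hIs).const_mul _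
  calc ∫ z, (1 + ∑ t : Fin n, (z.1 (s t) ^ 2 + z.2 (s t) ^ 2)) ^ d ∂μ
      ≤ ∫ z, cO ^ d * (1 + ∑ t : Fin n, (z.1 (s t) ^ (2 * (d + 1)) + z.2 (s t) ^ (2 * (d + 1)))) ∂μ :=
        integral_mono hint hrhs hpt
    _ = cO ^ d * (1 + ∑ t : Fin n, (∫ z, z.1 (s t) ^ (2 * (d + 1)) ∂μ + ∫ z, z.2 (s t) ^ (2 * (d + 1)) ∂μ)) := by
        have hsi : ∫ z, ∑ t : Fin n, (z.1 (s t) ^ (2 * (d + 1)) + z.2 (s t) ^ (2 * (d + 1))) ∂μ =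
            ∑ t : Fin n, (∫ z, z.1 (s t) ^ (2 * (d + 1)) ∂μ + ∫ z, z.2 (s t) ^ (2 * (d + 1)) ∂μ) := by
          rw [integral_finsetSum _ (f := fun t (z : PhaseSpace N) => z.1 (s t) ^ (2 * (d + 1)) + z.2 (s t) ^ (2 * (d + 1)))
            (fun t _ => (hIq t).add (hIp t))]
          exact Finset.sum_congr rfl fun t _ => integral_add (hIq t) (hIp t)
        rw [integral_const_mul, integral_add (integrable_const 1) hIs, hsi]
        simp only [integral_const, probReal_univ, smul_eq_mul, one_mul]
    _ ≤ cO ^ d * (1 + n * (K + K)) := by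
        have hc0 : 0 ≤ cO ^ d := by positivity
        refine mul_le_mul_of_nonneg_left ?_ hc0
        have hs : ∑ t : Fin n, (∫ z, z.1 (s t) ^ (2 * (d + 1)) ∂μ + ∫ z, z.2 (s t) ^ (2 * (d + 1)) ∂μ) ≤
            ∑ _t : Fin n, (K + K) :=
          Finset.sum_le_sum fun t _ => add_le_add (hK N (s t)).2.1 (hK N (s t)).2.2.2
        rw [Finset.sum_const, Finset.card_univ, Fintype.card_fin, nsmul_eq_mul] at hs
        linarith

end Pinned

/-- **Registered sub-goal `stub_overlapDensityLimit_siteSumMoments`** (part 1 of `stub_overlapDensityLimit`): `N`-uniform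
moments of every power of every site sum under the free finite-volume Gibbs state of the pinned chain — the closed
form of `pinnedChain_gibbs_siteSum_pow_le`. -/
theorem stub_overlapDensityLimit_siteSumMoments : ∀ ω₂ lam β γ T : ℝ, 0 < ω₂ → 0 < lam → 0 ≤ β → 0 < T → ∀ n d : ℕ, ∃ Mo : ℝ, ∀ (N : ℕ) (s : Fin n → Fin N), MeasureTheory.Integrable (fun z : Literature.MathematicalPhysics.KineticTheory.HeatConduction.PhaseSpace N => (1 + ∑ t : Fin n, (z.1 (s t) ^ 2 + z.2 (s t) ^ 2)) ^ d) ((Literature.MathematicalPhysics.KineticTheory.HeatConduction.pinnedChain ω₂ lam β γ).gibbsMeasure N T) ∧ ∫ z, (1 + ∑ t : Fin n, (z.1 (s t) ^ 2 + z.2 (s t) ^ 2)) ^ d ∂((Literature.MathematicalPhysics.KineticTheory.HeatConduction.pinnedChain ω₂ lam β γ).gibbsMeasure N T) ≤ Mo :=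
  fun _ _ _ γ _ hω hl hβ hT n d => pinnedChain_gibbs_siteSum_pow_le hω hl hβ γ hT n d

end Summit.AtomisticToContinuum.FouriersLaw.Theorems.OddChargeExists.OverlapDensityLimit

end
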